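/-
Copyright (c) 2026. All rights reserved.
Released under Apache 2.0 license as described in the file LICENSE.
-/
import Literature.NumberTheory.ComplexMultiplication.DegenerateCMTypesCyclicPrimePower
import HarnessLib

/-!
# The CM types of the cyclic group of order `2p^k`: Dodson's Prop. 4.1 for `ℤ_{p^k}` (weight prime to `p` ⟹
# nondegenerate) and primitive types at every level — Kubota's bound `φ(p^k) + 2` is attained; dimension `27`:
# the primitive ranks are exactly `28, 26, 22, 20`

Sequel to `DegenerateCMTypesCyclicPrimePower` (the ranks of the CM types of `⟨ρ⟩ × ℤ_{p^k}` by levels of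
equidistribution).  B. Dodson, *On the Mumford–Tate group of an abelian variety with complex multiplication*,
J. Algebra **111** (1987) [Dodson1987] (held text `paper:doi-10-1016-0021-8693-87-90242-0`, pp. 69–71), §4.1:

> PROPOSITION 4.1. "Let `f ∈ ℤ₂⁹` define a type on `⟨ρ⟩ × R₀`, for `R₀` one of the two regular groups of degree `9`.
> Then the type defined by `f` is nondegenerate whenever weight(`f`) is relatively prime to `3`."
> REMARK 4.5. "… the existence of simple Abelian varieties of dimension `n = 18, 27, 36, 54`, and `72` with rank `10`."

THIS FILE, for the cyclic group `R₀ = ℤ_{p^k}` and every odd `p`, every `k`: (1) Prop. 4.1 in general — a type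
whose weight `#{b : σᵇ ∈ S}` is prime to `p` is nondegenerate, because equidistribution at any level makes the
weight a multiple of `p`; (2) every exponent set `R ⊆ ℤ/p^k` is the trace on `⟨σ⟩` of a CM type; (3) EXPLICIT
PRIMITIVE TYPES: `R = {0}` (rank `p^k + 1`), `R = {p^{j−1}t : t < p}` (equidistributed at exactly the level `j`,
`1 ≤ j ≤ k − 1`: rank `p^k + 1 − φ(p^j)`), `R = [0, p^{k−1})` (equidistributed at every level `< k`: rank
`φ(p^k) + 2`, the minimum allowed by `le_typeRank_of_primitive`).  For `p^k = 27` this realises `28, 26, 22, 20`,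
and with `typeRank_mem_of_primitive_twentySeven` the primitive ranks of `⟨ρ⟩ × ℤ₂₇` are EXACTLY these.

## What is PROVED (theorems only; no definition, no named fact, no `sorry`)

* §1 digits (private): the bijection `ℤ/A × ℤ/B → ℤ/AB`, counting by the low digit, sums of periodic functions.
* §2 **`rowCount_eq_card_filter`** (the coset counts from the exponent set `R`), **`dvd_card_of_level`** (level
  `i + 1` ⟹ `p ∣ #R`), **`typeRank_eq_of_not_dvd_card`** ∕ `typeRank_eq_of_not_dvd_weight` (PROP. 4.1 for `ℤ_{p^k}`),
  **`exists_isCMTypeWith_exponents`** (every `R` is realised).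
* §3 **`exists_primitive_typeRank_eq_top`** (`p^k + 1`), **`exists_primitive_typeRank_eq_min`** (`φ(p^k) + 2`, all
  levels `< k`), **`exists_primitive_typeRank_eq_level`** (exactly level `j`: `rank + φ(p^j) = p^k + 1`),
  `exists_primitive_typeRank_eq` (summary).
* §4 `p^k = 27`: `exists_primitive_typeRank_eq_twentySeven`, **`typeRank_primitive_iff_twentySeven`** (a natural
  number is the rank of a primitive type of `⟨ρ⟩ × ℤ₂₇` iff it is `28, 26, 22` or `20`).

## References

* [Dodson1987] B. Dodson, J. Algebra 111 (1987) 49–73: §1.1, Prop. 4.1, Prop. 4.4 (1), Remark 4.5, Remark 4.7,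
  Thm. 3.2.1.
* [Kubota1965] T. Kubota, Trans. AMS 118 (1965), §4 Lemma 2.
* [Hazama2003CyclicCM] F. Hazama, J. Math. Sci. Univ. Tokyo 10 (2003), Prop. 4.1, Prop. 4.3.

## Provenance

Lane `lit-hodgefound` (Track 2, Layer A3 — CM types), seat `lit-hodgefound-p10` generation 35, row g35-#11;
neighbours cited by name, nothing restated: `DegenerateCMTypesCyclicPrimePower` (`typeRank_eq_iff`,
`typeRank_add_eq_of_primitive`, `forall_not_isStableUnder_iff`, `exists_coord`,
`typeRank_mem_of_primitive_twentySeven`), `DegenerateCMTypesCyclicTwoOddPrimes` (`rowCount`, `IsStableUnder`).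
-/

open scoped BigOperators

namespace Literature.NumberTheory.ComplexMultiplication

namespace CyclicCMType

namespace PrimePow

/-! ## §1 Digits and exponent sets -/

section Digits

variable {A B n : ℕ} [hA : NeZero A] [hB : NeZero B] [hn0 : NeZero n]

omit hA hB hn0 in
/-- Digits are unique: `Bx + c = Bx' + c'` with `c, c' < B` forces `x = x'`, `c = c'`. [folklore] -/
private theorem digits_inj {x x' c c' : ℕ} (hc : c < B) (hc' : c' < B) (h : B * x + c = B * x' + c') :
    x = x' ∧ c = c' := by
  have hB0 : 0 < B := by omega
  have e2 : c = c' := by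
    have := congrArg (· % B) h
    simpa only [Nat.mul_add_mod, Nat.mod_eq_of_lt hc, Nat.mod_eq_of_lt hc'] using this
  have e1 : x = x' := by
    have := congrArg (· / B) h
    simpa only [Nat.mul_add_div hB0, Nat.div_eq_of_lt hc, Nat.div_eq_of_lt hc', add_zero] using this
  exact ⟨e1, e2⟩

omit hA hB hn0 in
/-- `Bx + c < AB` for `x < A`, `c < B`. [folklore] -/
private theorem digits_lt {x c : ℕ} (hx : x < A) (hc : c < B) : B * x + c < A * B := by
  have h1 : B * x + c < B * x + B := by omega
  have h2 : B * x + B = B * (x + 1) := by ring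
  have h3 : B * (x + 1) ≤ B * A := Nat.mul_le_mul_left B hx
  rw [mul_comm A B]; omega

omit hn0 in
/-- **The digit map `(x, c) ↦ Bx + c : ℤ/A × ℤ/B → ℤ/AB` is a bijection.** [folklore] -/
private theorem digit_bijective [NeZero n] (hn : n = A * B) :
    Function.Bijective fun xc : ZMod A × ZMod B => ((B * xc.1.val + xc.2.val : ℕ) : ZMod n) := by
  subst hn
  rw [Fintype.bijective_iff_injective_and_card]
  refine ⟨?_, by rw [Fintype.card_prod, ZMod.card, ZMod.card, ZMod.card]⟩
  rintro ⟨x, c⟩ ⟨x', c'⟩ h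
  simp only at h
  rw [ZMod.natCast_eq_natCast_iff'] at h
  rw [Nat.mod_eq_of_lt (digits_lt (ZMod.val_lt x) (ZMod.val_lt c)),
    Nat.mod_eq_of_lt (digits_lt (ZMod.val_lt x') (ZMod.val_lt c'))] at h
  obtain ⟨e1, e2⟩ := digits_inj (ZMod.val_lt c) (ZMod.val_lt c') h
  exact Prod.ext (ZMod.val_injective A e1) (ZMod.val_injective B e2)

omit hn0 in
/-- The value of the digit `Bx + c` is `Bx + c`. [folklore] -/
private theorem val_digit [NeZero n] (hn : n = A * B) (x : ZMod A) (c : ZMod B) :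
    (((B * x.val + c.val : ℕ) : ZMod n)).val = B * x.val + c.val := by
  subst hn
  rw [ZMod.val_natCast, Nat.mod_eq_of_lt (digits_lt (ZMod.val_lt x) (ZMod.val_lt c))]

omit hA hB hn0 in
/-- Counting through a bijection. [folklore] -/
private theorem card_filter_comp_eq {α β : Type*} [Fintype α] [Fintype β] [DecidableEq β] {e : α → β}
    (he : Function.Bijective e) (P : β → Prop) [DecidablePred P] :
    (Finset.univ.filter fun a => P (e a)).card = (Finset.univ.filter P).card := by
  refine Finset.card_bij (fun a _ => e a) (fun a ha => ?_) (fun a _ a' _ h => he.1 h) fun b hb => ?_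
  · exact Finset.mem_filter.2 ⟨Finset.mem_univ _, (Finset.mem_filter.1 ha).2⟩
  · obtain ⟨a, rfl⟩ := he.2 b
    exact ⟨a, Finset.mem_filter.2 ⟨Finset.mem_univ _, (Finset.mem_filter.1 hb).2⟩, rfl⟩

omit hn0 in
/-- **Counting by the low digit**: `#{b ∈ ℤ/AB : P b} = Σ_{c ∈ ℤ/B} #{x ∈ ℤ/A : P(Bx + c)}`. [folklore] -/
private theorem card_filter_eq_sum_digit [NeZero n] (hn : n = A * B) (P : ZMod n → Prop) [DecidablePred P] :
    (Finset.univ.filter P).card =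
      ∑ c : ZMod B, (Finset.univ.filter fun x : ZMod A => P ((B * x.val + c.val : ℕ) : ZMod n)).card := by
  rw [← card_filter_comp_eq (digit_bijective hn) P, Finset.card_filter, Fintype.sum_prod_type_right]
  refine Finset.sum_congr rfl fun c _ => ?_
  rw [Finset.card_filter]

omit hA hB hn0 in
/-- Iterating a period. [folklore] -/
private theorem periodic_nsmul' {M : Type*} [AddCommMonoid M] {N : M → ℕ} {d : M} (hN : ∀ c, N (c + d) = N c)
    (c : M) (m : ℕ) : N (c + m • d) = N c := by
  induction m with
  | zero => rw [zero_smul, add_zero]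
  | succ m ih => rw [succ_nsmul, ← add_assoc, hN, ih]

omit hn0 in
/-- **The sum of a `B`-periodic function on `ℤ/AB` is `A` times its sum over the low digits.** [folklore] -/
private theorem sum_eq_mul_sum_of_periodic [NeZero n] (hn : n = A * B) {N : ZMod n → ℕ}
    (hN : ∀ c, N (c + (B : ZMod n)) = N c) :
    ∑ c : ZMod n, N c = A * ∑ y : ZMod B, N (y.val : ZMod n) := by
  rw [← (digit_bijective (A := A) (B := B) hn).sum_comp N, Fintype.sum_prod_type]
  have key : ∀ u : ZMod A, ∑ y : ZMod B, N ((B * (u, y).1.val + (u, y).2.val : ℕ) : ZMod n) =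
      ∑ y : ZMod B, N (y.val : ZMod n) := by
    intro u
    refine Finset.sum_congr rfl fun y _ => ?_
    have e : ((B * u.val + y.val : ℕ) : ZMod n) = (y.val : ZMod n) + u.val • (B : ZMod n) := by
      push_cast; rw [nsmul_eq_mul]; ring
    simp only
    rw [e, periodic_nsmul' hN]
  simp only at key ⊢
  rw [Finset.sum_congr rfl fun u _ => key u, Finset.sum_const, Finset.card_univ, ZMod.card, smul_eq_mul]

end Digits

/-! ## §2 The counts of a type on cosets, from its exponent set; Dodson's Prop. 4.1 for `ℤ_{p^k}` -/

section Exponents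

variable {G : Type*} [CommGroup G] [Fintype G] [DecidableEq G] {p : ℕ} [hp : Fact p.Prime] {k : ℕ} {ρ σ : G}
  {Φ : Finset G}

omit [Fintype G] [DecidableEq G] hp in
/-- `σ^{(N mod p^k)} = σ^N`. [folklore] -/
private theorem pow_val_natCast (hσ : orderOf σ = p ^ k) (N : ℕ) : σ ^ ((N : ZMod (p ^ k))).val = σ ^ N := by
  rw [ZMod.val_natCast, ← hσ, pow_mod_orderOf]

omit [Fintype G] [DecidableEq G] hp in
/-- The digits of an exponent: `(σ^{p^{i+1}})ˣ σᶜ = σ^{p^{i+1}x + c}`. [folklore] -/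
private theorem pow_digit (hσ : orderOf σ = p ^ k) (i : ℕ) (x : ZMod (p ^ (k - (i + 1))))
    (c : ZMod (p ^ (i + 1))) :
    (σ ^ p ^ (i + 1)) ^ x.val * σ ^ c.val = σ ^ (((p ^ (i + 1) * x.val + c.val : ℕ) : ZMod (p ^ k))).val := by
  rw [← pow_mul, ← pow_add, pow_val_natCast hσ]

omit [Fintype G] in
/-- **The coset counts from the exponent set.**  If `R ⊆ ℤ/p^k` is the set of exponents `b` with `σᵇ ∈ S`,
then `N(c) = #(S ∩ σᶜ⟨σ^{p^{i+1}}⟩) = #{x ∈ ℤ/p^{k−i−1} : p^{i+1}x + c ∈ R}`. [cite: Dodson1987, §4.1 (`f ∈ ℤ₂⁹`)]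
[cite: Hazama2003CyclicCM, Prop. 4.1] -/
theorem rowCount_eq_card_filter (hσ : orderOf σ = p ^ k) {R : Finset (ZMod (p ^ k))}
    (hR : ∀ b : ZMod (p ^ k), σ ^ b.val ∈ Φ ↔ b ∈ R) (i : ℕ) (c : ZMod (p ^ (i + 1))) :
    rowCount (p ^ (k - (i + 1))) (p ^ (i + 1)) Φ (σ ^ p ^ (i + 1)) σ c =
      (Finset.univ.filter fun x : ZMod (p ^ (k - (i + 1))) =>
        ((p ^ (i + 1) * x.val + c.val : ℕ) : ZMod (p ^ k)) ∈ R).card := by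
  unfold rowCount
  congr 1
  refine Finset.filter_congr fun x _ => ?_
  rw [pow_digit hσ i x c, hR]

omit [Fintype G] in
/-- **Equidistribution at a level forces `p ∣ weight`**: if the counts on the cosets of `⟨σ^{p^{i+1}}⟩` are
invariant under `σ^{p^i}`, the number of `b` with `σᵇ ∈ S` is `p` times a sum over `ℤ/p^i`.
[cite: Dodson1987, Prop. 4.1 (proof: (1.4.1))] -/
theorem dvd_card_of_level (hσ : orderOf σ = p ^ k) {R : Finset (ZMod (p ^ k))}
    (hR : ∀ b : ZMod (p ^ k), σ ^ b.val ∈ Φ ↔ b ∈ R) {i : ℕ} (hi : i < k)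
    (hL : ∀ c : ZMod (p ^ (i + 1)),
      rowCount (p ^ (k - (i + 1))) (p ^ (i + 1)) Φ (σ ^ p ^ (i + 1)) σ (c + (p ^ i : ℕ)) =
        rowCount (p ^ (k - (i + 1))) (p ^ (i + 1)) Φ (σ ^ p ^ (i + 1)) σ c) :
    p ∣ R.card := by
  have hn : p ^ k = p ^ (k - (i + 1)) * p ^ (i + 1) := by rw [← pow_add, Nat.sub_add_cancel hi]
  have hRc : R.card = (Finset.univ.filter fun b : ZMod (p ^ k) => b ∈ R).card := by
    rw [Finset.filter_mem_eq_inter, Finset.univ_inter]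
  rw [hRc, card_filter_eq_sum_digit hn]
  simp_rw [← rowCount_eq_card_filter hσ hR i]
  rw [sum_eq_mul_sum_of_periodic (A := p) (B := p ^ i) (pow_succ' p i) (fun c => by exact_mod_cast hL c)]
  exact Dvd.intro _ rfl

/-- **PROPOSITION 4.1 for `⟨ρ⟩ × ℤ_{p^k}`: a type whose weight is prime to `p` is nondegenerate** ("the type
defined by `f` is nondegenerate whenever weight(`f`) is relatively prime to `3`", for every `p` and `k`; the
weight is `#{b : σᵇ ∈ S} = #R`). [cite: Dodson1987, Prop. 4.1] [cite: Kubota1965, §4 Lemma 2] -/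
theorem typeRank_eq_of_not_dvd_card (hp2 : p ≠ 2) (hσ : orderOf σ = p ^ k) (hρσ : ρ ∉ Subgroup.zpowers σ)
    (hcard : Fintype.card G = 2 * p ^ k) (h : IsCMTypeWith ρ (Φ : Set G)) {R : Finset (ZMod (p ^ k))}
    (hR : ∀ b : ZMod (p ^ k), σ ^ b.val ∈ Φ ↔ b ∈ R) (hnd : ¬ p ∣ R.card) :
    typeRank G (Φ : Set G) = p ^ k + 1 :=
  (typeRank_eq_iff hp2 hσ hρσ hcard h).2 fun _ hi hL => hnd (dvd_card_of_level hσ hR hi hL)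

/-- **PROPOSITION 4.1, weight form**: `p ∤ #{b ∈ ℤ/p^k : σᵇ ∈ S}` ⟹ `rank(S) = p^k + 1`. [cite: Dodson1987, Prop. 4.1] -/
theorem typeRank_eq_of_not_dvd_weight (hp2 : p ≠ 2) (hσ : orderOf σ = p ^ k) (hρσ : ρ ∉ Subgroup.zpowers σ)
    (hcard : Fintype.card G = 2 * p ^ k) (h : IsCMTypeWith ρ (Φ : Set G))
    (hnd : ¬ p ∣ (Finset.univ.filter fun b : ZMod (p ^ k) => σ ^ b.val ∈ Φ).card) :
    typeRank G (Φ : Set G) = p ^ k + 1 :=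
  typeRank_eq_of_not_dvd_card hp2 hσ hρσ hcard h (R := Finset.univ.filter fun b : ZMod (p ^ k) => σ ^ b.val ∈ Φ)
    (fun b => by simp) hnd

/-- **Every exponent set is realised**: for `R ⊆ ℤ/p^k` the set `S_R = {σᵇ : b ∈ R} ∪ {ρσᵇ : b ∉ R}` is a CM
type of `⟨ρ⟩ × ⟨σ⟩` with `σᵇ ∈ S_R ⟺ b ∈ R` (Dodson's `f ∈ ℤ₂^{p^k}`). [cite: Dodson1987, §1.1 and §4.1] -/
theorem exists_isCMTypeWith_exponents (hσ : orderOf σ = p ^ k) (hρσ : ρ ∉ Subgroup.zpowers σ)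
    (hcard : Fintype.card G = 2 * p ^ k) (hρ2 : ρ * ρ = 1) (R : Finset (ZMod (p ^ k))) :
    ∃ Φ : Finset G, IsCMTypeWith ρ (Φ : Set G) ∧ ∀ b : ZMod (p ^ k), σ ^ b.val ∈ Φ ↔ b ∈ R := by
  have hσ' : orderOf σ = 1 * p ^ k := by rw [one_mul, hσ]
  have hcard' : Fintype.card G = 2 * (1 * p ^ k) := by rw [one_mul, hcard]
  have hσk : σ ^ p ^ k = 1 := by rw [← hσ]; exact pow_orderOf_eq_one σ
  have hinj : ∀ b c : ZMod (p ^ k), σ ^ b.val = σ ^ c.val → b = c := by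
    intro b c hbc
    rw [pow_eq_pow_iff_modEq, hσ] at hbc
    exact ZMod.val_injective _ (Nat.ModEq.eq_of_lt_of_lt hbc (ZMod.val_lt b) (ZMod.val_lt c))
  have hne : ∀ b c : ZMod (p ^ k), ρ * σ ^ b.val ≠ σ ^ c.val := by
    intro b c hbc
    apply hρσ
    have : ρ = σ ^ c.val * (σ ^ b.val)⁻¹ := by rw [← hbc, mul_inv_cancel_right]
    rw [this]
    exact mul_mem (pow_mem (Subgroup.mem_zpowers σ) _) (inv_mem (pow_mem (Subgroup.mem_zpowers σ) _))
  set Ψ : Finset G := Finset.univ.filter fun g =>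
    (∃ b ∈ R, g = σ ^ b.val) ∨ (∃ b ∉ R, g = ρ * σ ^ b.val) with hΨ
  have hmem1 : ∀ b : ZMod (p ^ k), σ ^ b.val ∈ Ψ ↔ b ∈ R := by
    intro b
    rw [hΨ, Finset.mem_filter]
    constructor
    · rintro ⟨-, ⟨c, hc, hbc⟩ | ⟨c, -, hbc⟩⟩
      · rwa [hinj b c hbc]
      · exact absurd hbc.symm (hne c b)
    · intro hb
      exact ⟨Finset.mem_univ _, Or.inl ⟨b, hb, rfl⟩⟩
  have hmem2 : ∀ b : ZMod (p ^ k), ρ * σ ^ b.val ∈ Ψ ↔ b ∉ R := by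
    intro b
    rw [hΨ, Finset.mem_filter]
    constructor
    · rintro ⟨-, ⟨c, -, hbc⟩ | ⟨c, hc, hbc⟩⟩
      · exact absurd hbc (hne b c)
      · rwa [hinj b c (mul_left_cancel hbc)]
    · intro hb
      exact ⟨Finset.mem_univ _, Or.inr ⟨b, hb, rfl⟩⟩
  refine ⟨Ψ, ⟨fun x => ?_, fun g x => ?_, fun x => ?_⟩, hmem1⟩
  · obtain ⟨⟨a, c⟩, rfl | rfl⟩ := exists_coord hσ' hρσ hcard' x
    · simp only [hσk, one_pow, one_mul, Finset.mem_coe, smul_eq_mul]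
      rw [hmem1, hmem2, not_not]
    · simp only [hσk, one_pow, one_mul, Finset.mem_coe, smul_eq_mul]
      rw [← mul_assoc, hρ2, one_mul, hmem1, hmem2]
  · simp only [smul_eq_mul]
    rw [mul_left_comm]
  · simp only [smul_eq_mul]
    rw [← mul_assoc, hρ2, one_mul]

end Exponents

/-! ## §3 Existence: primitive types at each level, and Kubota's bound `φ(p^k) + 2` attained -/

section Existence

variable {G : Type*} [CommGroup G] [Fintype G] [DecidableEq G] {p : ℕ} [hp : Fact p.Prime] {ρ σ : G}

/-- The telescoping sum `Σ_{i<n} (p^{i+1} − p^i) = p^n − 1`. [folklore] -/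
private theorem sum_totient_levels (n : ℕ) : ∑ i ∈ Finset.range n, (p ^ (i + 1) - p ^ i) = p ^ n - 1 := by
  induction n with
  | zero => simp
  | succ n ih =>
    rw [Finset.sum_range_succ, ih]
    have h1 : 1 ≤ p ^ n := Nat.one_le_pow _ _ hp.out.pos
    have h2 : p ^ n ≤ p ^ (n + 1) := Nat.pow_le_pow_right hp.out.pos (Nat.le_succ n)
    omega

omit [Fintype G] [DecidableEq G] hp in
/-- Not stable under `σ^{p^m}`: `1 ∈ S` and `σ^{p^m} ∉ S`. [folklore] -/
private theorem not_isStableUnder_of_one_mem {m : ℕ} (hσ : orderOf σ = p ^ (m + 1)) {Φ : Finset G}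
    {R : Finset (ZMod (p ^ (m + 1)))} (hR : ∀ b : ZMod (p ^ (m + 1)), σ ^ b.val ∈ Φ ↔ b ∈ R)
    (h0 : (0 : ZMod (p ^ (m + 1))) ∈ R) (h1 : ((p ^ m : ℕ) : ZMod (p ^ (m + 1))) ∉ R) :
    ¬ IsStableUnder Φ (σ ^ p ^ (m + 1 - 1)) := by
  intro hst
  have h := hst 1
  rw [mul_one, Nat.add_sub_cancel, ← pow_val_natCast hσ (p ^ m), hR,
    show (1 : G) = σ ^ (0 : ZMod (p ^ (m + 1))).val by rw [ZMod.val_zero, pow_zero], hR] at h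
  exact h1 (h.1 h0)

omit hp in
/-- The value of `p^m` in `ℤ/p^{m+1}`. [folklore] -/
private theorem val_cast_pow (hp1 : 1 < p) (m : ℕ) : (((p ^ m : ℕ) : ZMod (p ^ (m + 1)))).val = p ^ m := by
  rw [ZMod.val_natCast, Nat.mod_eq_of_lt (Nat.pow_lt_pow_right hp1 (Nat.lt_succ_self m))]

omit hp in
/-- The value of `p^i` in `ℤ/p^{i+1}`, added to `0`. [folklore] -/
private theorem val_zero_add_cast_pow (hp1 : 1 < p) (i : ℕ) :
    ((0 : ZMod (p ^ (i + 1))) + ((p ^ i : ℕ) : ZMod (p ^ (i + 1)))).val = p ^ i := by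
  rw [zero_add, val_cast_pow hp1]

/-- **A PRIMITIVE NONDEGENERATE TYPE** (weight `1`: `S ∩ ⟨σ⟩ = {1}`), rank `p^k + 1`.
[cite: Dodson1987, Prop. 4.1] -/
theorem exists_primitive_typeRank_eq_top (hp2 : p ≠ 2) {m : ℕ} (hσ : orderOf σ = p ^ (m + 1))
    (hρσ : ρ ∉ Subgroup.zpowers σ) (hcard : Fintype.card G = 2 * p ^ (m + 1)) (hρ2 : ρ * ρ = 1) :
    ∃ Φ : Finset G, IsCMTypeWith ρ (Φ : Set G) ∧ (∀ u : G, u ≠ 1 → ¬ IsStableUnder Φ u) ∧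
      typeRank G (Φ : Set G) = p ^ (m + 1) + 1 := by
  obtain ⟨Φ, h, hR⟩ := exists_isCMTypeWith_exponents hσ hρσ hcard hρ2 {0}
  have hpm : ((p ^ m : ℕ) : ZMod (p ^ (m + 1))) ∉ ({0} : Finset (ZMod (p ^ (m + 1)))) := by
    rw [Finset.mem_singleton]
    intro h0
    have := congrArg ZMod.val h0
    rw [val_cast_pow hp.out.one_lt, ZMod.val_zero] at this
    exact (pow_pos hp.out.pos m).ne' this
  refine ⟨Φ, h, (forall_not_isStableUnder_iff hp2 hσ (Nat.le_add_left 1 m) hρσ hcard h).2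
    (not_isStableUnder_of_one_mem hσ hR (Finset.mem_singleton_self 0) hpm), ?_⟩
  exact typeRank_eq_of_not_dvd_card hp2 hσ hρσ hcard h hR
    (by rw [Finset.card_singleton]; exact hp.out.not_dvd_one)

/-- **KUBOTA'S BOUND `φ(p^k) + 2` IS ATTAINED**: the type with `S ∩ ⟨σ⟩ = {σᵇ : 0 ≤ b < p^{k−1}}` (an initial
segment of exponents) is primitive, equidistributed at EVERY level `< k`, and has rank `p^k − p^{k−1} + 2` — for
`k = 2` Dodson's rank-`8` orbits ∕ Serre's type; dimension `27`: rank `20`. [cite: Dodson1987, Prop. 4.4 (1) and Thm. 1.12]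
[cite: Kubota1965, §4 Lemma 2] -/
theorem exists_primitive_typeRank_eq_min (hp2 : p ≠ 2) {m : ℕ} (hσ : orderOf σ = p ^ (m + 1))
    (hρσ : ρ ∉ Subgroup.zpowers σ) (hcard : Fintype.card G = 2 * p ^ (m + 1)) (hρ2 : ρ * ρ = 1) :
    ∃ Φ : Finset G, IsCMTypeWith ρ (Φ : Set G) ∧ (∀ u : G, u ≠ 1 → ¬ IsStableUnder Φ u) ∧
      (∀ i < m, ∀ c : ZMod (p ^ (i + 1)),
        rowCount (p ^ (m + 1 - (i + 1))) (p ^ (i + 1)) Φ (σ ^ p ^ (i + 1)) σ (c + (p ^ i : ℕ)) =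
          rowCount (p ^ (m + 1 - (i + 1))) (p ^ (i + 1)) Φ (σ ^ p ^ (i + 1)) σ c) ∧
      typeRank G (Φ : Set G) = p ^ (m + 1) - p ^ m + 2 := by
  classical
  set R : Finset (ZMod (p ^ (m + 1))) := Finset.univ.filter fun b => b.val < p ^ m with hRdef
  obtain ⟨Φ, h, hR⟩ := exists_isCMTypeWith_exponents hσ hρσ hcard hρ2 R
  -- the coset counts do not depend on the coset: `N_i(c) = p^{m−i−1}` … as the count of `x < p^{m−i−1}`
  have hN : ∀ i < m, ∀ c : ZMod (p ^ (i + 1)),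
      rowCount (p ^ (m + 1 - (i + 1))) (p ^ (i + 1)) Φ (σ ^ p ^ (i + 1)) σ c =
        (Finset.univ.filter fun x : ZMod (p ^ (m + 1 - (i + 1))) => x.val < p ^ (m - (i + 1))).card := by
    intro i hi c
    have hn : p ^ (m + 1) = p ^ (m + 1 - (i + 1)) * p ^ (i + 1) := by
      rw [← pow_add, Nat.sub_add_cancel (by omega)]
    have hM : p ^ m = p ^ (i + 1) * p ^ (m - (i + 1)) := by rw [← pow_add, Nat.add_sub_cancel' hi]
    rw [rowCount_eq_card_filter hσ hR i c]
    refine congrArg Finset.card (Finset.filter_congr fun x _ => ?_)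
    rw [hRdef, Finset.mem_filter, val_digit hn x c]
    simp only [Finset.mem_univ, true_and]
    have hc := ZMod.val_lt c
    constructor
    · intro hlt
      have : p ^ (i + 1) * x.val < p ^ (i + 1) * p ^ (m - (i + 1)) := by rw [← hM]; omega
      exact Nat.lt_of_mul_lt_mul_left this
    · intro hx
      have : p ^ (i + 1) * (x.val + 1) ≤ p ^ (i + 1) * p ^ (m - (i + 1)) := Nat.mul_le_mul_left _ hx
      rw [← hM, mul_add, mul_one] at this
      omega
  have hL : ∀ i < m, ∀ c : ZMod (p ^ (i + 1)),
      rowCount (p ^ (m + 1 - (i + 1))) (p ^ (i + 1)) Φ (σ ^ p ^ (i + 1)) σ (c + (p ^ i : ℕ)) =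
        rowCount (p ^ (m + 1 - (i + 1))) (p ^ (i + 1)) Φ (σ ^ p ^ (i + 1)) σ c := by
    intro i hi c
    rw [hN i hi, hN i hi]
  have h0 : (0 : ZMod (p ^ (m + 1))) ∈ R := by
    rw [hRdef, Finset.mem_filter, ZMod.val_zero]
    exact ⟨Finset.mem_univ _, pow_pos hp.out.pos m⟩
  have h1 : ((p ^ m : ℕ) : ZMod (p ^ (m + 1))) ∉ R := by
    rw [hRdef, Finset.mem_filter, val_cast_pow hp.out.one_lt]
    exact fun hh => lt_irrefl _ hh.2
  have hprim := (forall_not_isStableUnder_iff hp2 hσ (Nat.le_add_left 1 m) hρσ hcard h).2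
    (not_isStableUnder_of_one_mem hσ hR h0 h1)
  refine ⟨Φ, h, hprim, hL, ?_⟩
  have key := typeRank_add_eq_of_primitive hp2 hσ hρσ hcard h hprim
  rw [Finset.sum_congr rfl fun i hi => if_pos (hL i (Finset.mem_range.1 hi)), sum_totient_levels] at key
  have e1 : 1 ≤ p ^ m := Nat.one_le_pow _ _ hp.out.pos
  have e2 : p ^ m ≤ p ^ (m + 1) := Nat.pow_le_pow_right hp.out.pos (Nat.le_succ m)
  omega

/-- **A PRIMITIVE TYPE EQUIDISTRIBUTED AT EXACTLY ONE LEVEL `j = i₀ + 1 ≤ k − 1`**: `S ∩ ⟨σ⟩ =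
{σ^{p^{i₀} t} : 0 ≤ t < p}` (the `p` multiples of `p^{i₀}` below `p^{i₀+1}`) has rank `p^k + 1 − φ(p^j)` — simple
abelian `p^k`-folds of rank `p^k + 1 − (p^j − p^{j−1})` for every `1 ≤ j ≤ k − 1` (dimension `27`: ranks `26`
and `22`). [cite: Dodson1987, Prop. 4.4 (1), Remark 4.5 and Thm. 3.2.1] [cite: Kubota1965, §4 Lemma 2] -/
theorem exists_primitive_typeRank_eq_level (hp2 : p ≠ 2) {m : ℕ} (hσ : orderOf σ = p ^ (m + 1))
    (hρσ : ρ ∉ Subgroup.zpowers σ) (hcard : Fintype.card G = 2 * p ^ (m + 1)) (hρ2 : ρ * ρ = 1) {i₀ : ℕ}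
    (hi₀ : i₀ < m) :
    ∃ Φ : Finset G, IsCMTypeWith ρ (Φ : Set G) ∧ (∀ u : G, u ≠ 1 → ¬ IsStableUnder Φ u) ∧
      (∀ i < m, (∀ c : ZMod (p ^ (i + 1)),
        rowCount (p ^ (m + 1 - (i + 1))) (p ^ (i + 1)) Φ (σ ^ p ^ (i + 1)) σ (c + (p ^ i : ℕ)) =
          rowCount (p ^ (m + 1 - (i + 1))) (p ^ (i + 1)) Φ (σ ^ p ^ (i + 1)) σ c) ↔ i = i₀) ∧
      typeRank G (Φ : Set G) + (p ^ (i₀ + 1) - p ^ i₀) = p ^ (m + 1) + 1 := by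
  classical
  set R : Finset (ZMod (p ^ (m + 1))) :=
    Finset.univ.filter fun b => p ^ i₀ ∣ b.val ∧ b.val < p ^ (i₀ + 1) with hRdef
  obtain ⟨Φ, h, hR⟩ := exists_isCMTypeWith_exponents hσ hρσ hcard hρ2 R
  have hp0 := hp.out.pos
  have hp1 := hp.out.one_lt
  -- the counts in terms of `R`
  have hNval : ∀ i < m, ∀ (c : ZMod (p ^ (i + 1))) (x : ZMod (p ^ (m + 1 - (i + 1)))),
      (((p ^ (i + 1) * x.val + c.val : ℕ) : ZMod (p ^ (m + 1))) ∈ R ↔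
        p ^ i₀ ∣ p ^ (i + 1) * x.val + c.val ∧ p ^ (i + 1) * x.val + c.val < p ^ (i₀ + 1)) := by
    intro i hi c x
    have hn : p ^ (m + 1) = p ^ (m + 1 - (i + 1)) * p ^ (i + 1) := by
      rw [← pow_add, Nat.sub_add_cancel (by omega)]
    rw [hRdef, Finset.mem_filter, val_digit hn x c]
    simp only [Finset.mem_univ, true_and]
  -- level `i₀ + 1`: `N(c) = [p^{i₀} ∣ c]`
  have hN₀ : ∀ c : ZMod (p ^ (i₀ + 1)),
      rowCount (p ^ (m + 1 - (i₀ + 1))) (p ^ (i₀ + 1)) Φ (σ ^ p ^ (i₀ + 1)) σ c =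
        (Finset.univ.filter fun x : ZMod (p ^ (m + 1 - (i₀ + 1))) => x.val = 0 ∧ p ^ i₀ ∣ c.val).card := by
    intro c
    rw [rowCount_eq_card_filter hσ hR i₀ c]
    refine congrArg Finset.card (Finset.filter_congr fun x _ => ?_)
    rw [hNval i₀ hi₀ c x]
    have hc := ZMod.val_lt c
    constructor
    · rintro ⟨hdvd, hlt⟩
      have hx : x.val = 0 := by
        by_contra hx
        have : p ^ (i₀ + 1) * 1 ≤ p ^ (i₀ + 1) * x.val := Nat.mul_le_mul_left _ (Nat.pos_of_ne_zero hx)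
        omega
      rw [hx, mul_zero, zero_add] at hdvd
      exact ⟨hx, hdvd⟩
    · rintro ⟨hx, hdvd⟩
      rw [hx, mul_zero, zero_add]
      exact ⟨hdvd, hc⟩
  have hL₀ : ∀ c : ZMod (p ^ (i₀ + 1)),
      rowCount (p ^ (m + 1 - (i₀ + 1))) (p ^ (i₀ + 1)) Φ (σ ^ p ^ (i₀ + 1)) σ (c + (p ^ i₀ : ℕ)) =
        rowCount (p ^ (m + 1 - (i₀ + 1))) (p ^ (i₀ + 1)) Φ (σ ^ p ^ (i₀ + 1)) σ c := by
    intro c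
    rw [hN₀, hN₀]
    refine congrArg Finset.card (Finset.filter_congr fun x _ => ?_)
    have hval : (c + ((p ^ i₀ : ℕ) : ZMod (p ^ (i₀ + 1)))).val = (c.val + p ^ i₀) % p ^ (i₀ + 1) := by
      rw [ZMod.val_add, val_cast_pow hp1]
    rw [hval, Nat.dvd_mod_iff (pow_dvd_pow p (Nat.le_succ i₀)), Nat.dvd_add_left (dvd_refl _)]
  -- the other levels fail at `c = 0`: `N(0) ≥ 1` (`x = 0`), `N(p^i) = 0`
  have hfail : ∀ i < m, i ≠ i₀ →
      ¬ ∀ c : ZMod (p ^ (i + 1)),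
        rowCount (p ^ (m + 1 - (i + 1))) (p ^ (i + 1)) Φ (σ ^ p ^ (i + 1)) σ (c + (p ^ i : ℕ)) =
          rowCount (p ^ (m + 1 - (i + 1))) (p ^ (i + 1)) Φ (σ ^ p ^ (i + 1)) σ c := by
    intro i hi hne H
    have H0 := H 0
    rw [rowCount_eq_card_filter hσ hR i, rowCount_eq_card_filter hσ hR i] at H0
    have hn : p ^ (m + 1) = p ^ (m + 1 - (i + 1)) * p ^ (i + 1) := by
      rw [← pow_add, Nat.sub_add_cancel (by omega)]
    haveI : NeZero (p ^ (m + 1 - (i + 1))) := inferInstance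
    -- right side: `x = 0` is counted
    have hpos : 0 < (Finset.univ.filter fun x : ZMod (p ^ (m + 1 - (i + 1))) =>
        (((p ^ (i + 1) * x.val + (0 : ZMod (p ^ (i + 1))).val : ℕ) : ZMod (p ^ (m + 1)))) ∈ R).card := by
      refine Finset.card_pos.2 ⟨0, Finset.mem_filter.2 ⟨Finset.mem_univ _, ?_⟩⟩
      rw [hNval i hi 0 0, ZMod.val_zero, ZMod.val_zero, mul_zero, add_zero]
      exact ⟨dvd_zero _, pow_pos hp0 _⟩
    -- left side: nothing is counted
    have hzero : (Finset.univ.filter fun x : ZMod (p ^ (m + 1 - (i + 1))) =>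
        (((p ^ (i + 1) * x.val + ((0 : ZMod (p ^ (i + 1))) + ((p ^ i : ℕ) : ZMod (p ^ (i + 1)))).val : ℕ) :
          ZMod (p ^ (m + 1)))) ∈ R).card = 0 := by
      refine Finset.card_eq_zero.2 (Finset.filter_eq_empty_iff.2 fun x _ => ?_)
      rw [hNval i hi _ x, val_zero_add_cast_pow hp1]
      rintro ⟨hdvd, hlt⟩
      rcases Nat.lt_or_gt_of_ne hne with hlt' | hgt
      · -- `i < i₀`: `p^{i+1} ∣ p^{i+1} x + p^i`, impossible
        have h1 : p ^ (i + 1) ∣ p ^ (i + 1) * x.val + p ^ i := (pow_dvd_pow p hlt').trans hdvd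
        have h2 : p ^ (i + 1) ∣ p ^ i := (Nat.dvd_add_right (dvd_mul_right _ _)).1 h1
        have h3 := Nat.le_of_dvd (pow_pos hp0 i) h2
        have h4 : p ^ i < p ^ (i + 1) := Nat.pow_lt_pow_right hp1 (Nat.lt_succ_self i)
        omega
      · -- `i₀ < i`: `p^{i+1} x + p^i ≥ p^i ≥ p^{i₀+1}`
        have h1 : p ^ (i₀ + 1) ≤ p ^ i := Nat.pow_le_pow_right hp0 hgt
        omega
    rw [hzero] at H0
    exact hpos.ne' H0.symm
  have hlevels : ∀ i < m, ((∀ c : ZMod (p ^ (i + 1)),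
      rowCount (p ^ (m + 1 - (i + 1))) (p ^ (i + 1)) Φ (σ ^ p ^ (i + 1)) σ (c + (p ^ i : ℕ)) =
        rowCount (p ^ (m + 1 - (i + 1))) (p ^ (i + 1)) Φ (σ ^ p ^ (i + 1)) σ c) ↔ i = i₀) := by
    intro i hi
    constructor
    · intro H
      by_contra hne
      exact hfail i hi hne H
    · rintro rfl
      exact hL₀
  have h0 : (0 : ZMod (p ^ (m + 1))) ∈ R := by
    rw [hRdef, Finset.mem_filter, ZMod.val_zero]
    exact ⟨Finset.mem_univ _, dvd_zero _, pow_pos hp0 _⟩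
  have h1 : ((p ^ m : ℕ) : ZMod (p ^ (m + 1))) ∉ R := by
    rw [hRdef, Finset.mem_filter, val_cast_pow hp1]
    rintro ⟨-, -, hlt⟩
    have : p ^ (i₀ + 1) ≤ p ^ m := Nat.pow_le_pow_right hp0 hi₀
    omega
  have hprim := (forall_not_isStableUnder_iff hp2 hσ (Nat.le_add_left 1 m) hρσ hcard h).2
    (not_isStableUnder_of_one_mem hσ hR h0 h1)
  refine ⟨Φ, h, hprim, hlevels, ?_⟩
  have key := typeRank_add_eq_of_primitive hp2 hσ hρσ hcard h hprim
  have hsum : ∑ i ∈ Finset.range m,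
      (if (∀ c : ZMod (p ^ (i + 1)),
          rowCount (p ^ (m + 1 - (i + 1))) (p ^ (i + 1)) Φ (σ ^ p ^ (i + 1)) σ (c + (p ^ i : ℕ)) =
            rowCount (p ^ (m + 1 - (i + 1))) (p ^ (i + 1)) Φ (σ ^ p ^ (i + 1)) σ c)
        then p ^ (i + 1) - p ^ i else 0) =
      ∑ i ∈ Finset.range m, (if i = i₀ then p ^ (i + 1) - p ^ i else 0) := by
    refine Finset.sum_congr rfl fun i hi => ?_
    rw [Finset.mem_range] at hi
    by_cases hii : i = i₀
    · rw [if_pos ((hlevels i hi).2 hii), if_pos hii]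
    · rw [if_neg (fun H => hii ((hlevels i hi).1 H)), if_neg hii]
  rw [hsum, Finset.sum_ite_eq', if_pos (Finset.mem_range.2 hi₀)] at key
  exact key

/-- **The primitive ranks of `⟨ρ⟩ × ℤ_{p^k}` include `p^k + 1`, `p^k + 1 − φ(p^j)` (`1 ≤ j ≤ k − 1`) and
`φ(p^k) + 2`** — at least `k + 1` values for `k ≥ 2` (Remark 4.7's "`6, 8, 10` … do occur" is `k = 2`, `p = 3`
together with the non-cyclic group). [cite: Dodson1987, Prop. 4.4 (1), Remark 4.5 and Remark 4.7] -/
theorem exists_primitive_typeRank_eq (hp2 : p ≠ 2) {m : ℕ} (hσ : orderOf σ = p ^ (m + 1))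
    (hρσ : ρ ∉ Subgroup.zpowers σ) (hcard : Fintype.card G = 2 * p ^ (m + 1)) (hρ2 : ρ * ρ = 1) (r : ℕ)
    (hr : r = p ^ (m + 1) + 1 ∨ r = p ^ (m + 1) - p ^ m + 2 ∨
      ∃ i₀ < m, r + (p ^ (i₀ + 1) - p ^ i₀) = p ^ (m + 1) + 1) :
    ∃ Φ : Finset G, IsCMTypeWith ρ (Φ : Set G) ∧ (∀ u : G, u ≠ 1 → ¬ IsStableUnder Φ u) ∧
      typeRank G (Φ : Set G) = r := by
  rcases hr with rfl | rfl | ⟨i₀, hi₀, hr⟩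
  · exact exists_primitive_typeRank_eq_top hp2 hσ hρσ hcard hρ2
  · obtain ⟨Φ, h, hprim, -, hrk⟩ := exists_primitive_typeRank_eq_min hp2 hσ hρσ hcard hρ2
    exact ⟨Φ, h, hprim, hrk⟩
  · obtain ⟨Φ, h, hprim, -, hrk⟩ := exists_primitive_typeRank_eq_level hp2 hσ hρσ hcard hρ2 hi₀
    exact ⟨Φ, h, hprim, by omega⟩

end Existence

/-! ## §4 `p^k = 27`: the primitive ranks are exactly `28, 26, 22, 20` -/

section TwentySeven

variable {G : Type*} [CommGroup G] [Fintype G] [DecidableEq G] {ρ σ : G}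

/-- **`⟨ρ⟩ × ℤ₂₇`: every one of `28, 26, 22, 20` is the rank of a primitive type** (weights `1`;
`{1, σ, σ²}`-type at level `1`; `{1, σ³, σ⁶}` at level `2`; `{σᵇ : b < 9}` at levels `1, 2`).
[cite: Dodson1987, Prop. 4.4 (1) and Remark 4.5] [cite: Kubota1965, §4 Lemma 2] -/
theorem exists_primitive_typeRank_eq_twentySeven (hσ : orderOf σ = 27) (hρσ : ρ ∉ Subgroup.zpowers σ)
    (hcard : Fintype.card G = 54) (hρ2 : ρ * ρ = 1) {r : ℕ} (hr : r ∈ ({28, 26, 22, 20} : Finset ℕ)) :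
    ∃ Φ : Finset G, IsCMTypeWith ρ (Φ : Set G) ∧ (∀ u : G, u ≠ 1 → ¬ IsStableUnder Φ u) ∧
      typeRank G (Φ : Set G) = r := by
  haveI : Fact (Nat.Prime 3) := ⟨Nat.prime_three⟩
  have hσ' : orderOf σ = 3 ^ (2 + 1) := by rw [hσ]; norm_num
  have hcard' : Fintype.card G = 2 * 3 ^ (2 + 1) := by rw [hcard]; norm_num
  refine exists_primitive_typeRank_eq (p := 3) (by norm_num) hσ' hρσ hcard' hρ2 r ?_
  simp only [Finset.mem_insert, Finset.mem_singleton] at hr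
  rcases hr with rfl | rfl | rfl | rfl
  · left; norm_num
  · right; right; exact ⟨0, by norm_num, by norm_num⟩
  · right; right; exact ⟨1, by norm_num, by norm_num⟩
  · right; left; norm_num

/-- **`⟨ρ⟩ × ℤ₂₇`: the set of ranks of the primitive types is EXACTLY `{28, 26, 22, 20}`.**
[cite: Dodson1987, Prop. 4.4 (1) and Remark 4.5] [cite: Kubota1965, §4 Lemma 2] -/
theorem typeRank_primitive_iff_twentySeven (hσ : orderOf σ = 27) (hρσ : ρ ∉ Subgroup.zpowers σ)
    (hcard : Fintype.card G = 54) (hρ2 : ρ * ρ = 1) (r : ℕ) :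
    (∃ Φ : Finset G, IsCMTypeWith ρ (Φ : Set G) ∧ (∀ u : G, u ≠ 1 → ¬ IsStableUnder Φ u) ∧
      typeRank G (Φ : Set G) = r) ↔ r ∈ ({28, 26, 22, 20} : Finset ℕ) := by
  constructor
  · rintro ⟨Φ, h, hprim, rfl⟩
    exact typeRank_mem_of_primitive_twentySeven hσ hρσ hcard h hprim
  · exact exists_primitive_typeRank_eq_twentySeven hσ hρσ hcard hρ2

end TwentySeven

end PrimePow

end CyclicCMType

end Literature.NumberTheory.ComplexMultiplication
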